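import Summits.Ventures.DiscreteObjects.Hadamard.Order167CentralizerFree668
import Summits.Ventures.DiscreteObjects.Hadamard.ElemAbelianRank2Small
import Summits.Ventures.DiscreteObjects.Hadamard.ElemAbelianPTools
import Summits.Ventures.DiscreteObjects.Hadamard.PrimeOrderFixedRows668

/-!
# H(668): for the primes `p = 37, 41` (and again `83, 167`) the centraliser of an element of order `p` acts faithfully on its
# row orbits — a uniform engine (kernel)

Framing: lottery ticket; floor = certified bounds/negative ranges.

Cell pub-namedobj (venture DiscreteObjects), target (H), hadamard gen 21.  Uniform form of gen 19's `Order167Centralizer668` and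
gen 21's `Order83Centralizer668`.  Let `H` be a Hadamard matrix of order `668`.
* **`card_fixed_le_332_of_prime_pair`** (uniform census bound): a signed automorphism whose permutation pair is non-trivial of
  prime exponent `q` fixes at most `332` rows [spectrum `{2,3,5,7,11,13,23,37,41,83,167}` and the per-prime censuses: involutions
  `≤ 332`, `3: ≤ 164`, `5: ≤ 108`, `7: ≤ 80`, `11: ≤ 52`, `13: 44`, `23: ≤ 24`, `37: 2`, `41: 12`, `83: 4`, `167: 0`].
* **`centralizer_rowOrbits_of_prime`** (engine): let `σ = (π, κ, d, e)` be a signed automorphism with `π^p = κ^p = 1`,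
  `(π, κ) ≠ (1,1)`, `p` prime, such that EVERY non-trivial signed automorphism of pair exponent `p` fixes exactly `f` rows, with
  `f < p` and `f < 336`.  If `τ = (π', κ', d', e')` commutes with `σ` and maps every `π`-moved row into its own orbit, then
  `(π', κ') = (π^c, κ^c)`.  [`ρ = τσ^m` fixes the orbit of a moved row pointwise; for a prime `q ∣ orderOf ρ`, the power `Q` of
  order `q` either has `q = p` — then it fixes `≥ p > f` rows — or `q ≠ p` — then it is trivial on every moved row (it acts there
  as `π^{kc}` with `p ∣ qkc`), fixing `≥ 668 − f > 332` rows; both contradict the census.  So `orderOf ρ = 1`.]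
* Instances **`hadamard668_order37_centralizer_rowOrbits`** (`f = 2`), **`hadamard668_order41_centralizer_rowOrbits`**
  (`f = 12`): the orbit-preserving centraliser of an element of order `37` / `41` is `⟨σ⟩` — `C(σ)/⟨σ⟩` acts FAITHFULLY on the
  `18` resp. `16` row orbits.  (Not available this way for `13` and `23`, where `f ≥ p` — an element of order `p` could be the
  shift on some orbits and the identity on others as far as counting goes.)
STRUCTURE of a hypothetical object; H(668) untouched; HITS 0/4.  Ours; no `sorry`, no definitions, default heartbeats.
-/

namespace Summit.Ventures.DiscreteObjects.Hadamard

open Finset BigOperators Matrix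

open Literature.Combinatorics.Designs.GoethalsSeidel (IsHadamardMatrix)

variable {ι : Type*} [Fintype ι] [DecidableEq ι]

section census
variable {H : Matrix ι ι ℤ}

/-- **Uniform census bound.**  A signed automorphism of an H(668) with non-trivial permutation pair of prime exponent `q`
fixes at most `332` rows. -/
theorem card_fixed_le_332_of_prime_pair (hH : IsHadamardMatrix H) (hι : Fintype.card ι = 668)
    {ψ χ : Equiv.Perm ι} {d e : ι → ℤ} (haut : IsSignedAut H ψ χ d e) {q : ℕ} (hq : q.Prime) (h1 : ψ ^ q = 1)
    (h2 : χ ^ q = 1) (hne : ψ ≠ 1 ∨ χ ≠ 1) : (univ.filter fun i => ψ i = i).card ≤ 332 := by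
  have hcard : (Fintype.card ι : ℤ) ≠ 0 := by rw [hι]; norm_num
  have hmem := hadamard668_signedAut_prime_mem' hH hι q hq ψ χ d e haut h1 h2 hne
  simp only [Finset.mem_insert, Finset.mem_singleton] at hmem
  -- for odd q the row part is non-trivial
  have hψ1 : q ≠ 2 → ψ ≠ 1 := by
    intro hq2 hψ
    rw [hψ] at haut
    have hodd : Odd q := hq.odd_of_ne_two hq2
    rcases hne with h | h
    · exact h hψ
    · exact h (signedAut_snd_eq_one H hH hcard haut hodd h2)
  rcases hmem with rfl | rfl | rfl | rfl | rfl | h13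
  · -- involutions
    obtain ⟨-, -, hcases⟩ := hadamard668_involution_census_final hH hι ψ χ d e haut h1 h2 hne
    rcases hcases with ⟨-, -, -, h332, -⟩ | ⟨h0, -, -, -⟩
    · exact h332
    · omega
  · have h := (census3 hH hι haut h1 h2 (hψ1 (by norm_num))).2.2.1; omega
  · have h := (census5 hH hι haut h1 h2 (hψ1 (by norm_num))).2.2.1; omega
  · have h := (census7 hH hι haut h1 h2 (hψ1 (by norm_num))).2
    rcases h with h | h | h | h | h <;> omega
  · have h := (census11 hH hι haut h1 h2 (hψ1 (by norm_num))).2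
    rcases h with h | h | h <;> omega
  · have hq13 : 13 ≤ q := by rcases h13 with rfl | rfl | rfl | rfl | rfl | rfl <;> norm_num
    obtain ⟨-, h⟩ := hadamard668_signedAut_fixedRows hH hι q hq hq13 ψ χ d e haut h1 h2 hne
    rcases h with ⟨-, h⟩ | ⟨-, h | h⟩ | ⟨-, h⟩ | ⟨-, h⟩ | ⟨-, h⟩ | ⟨-, h⟩ <;> omega

end census

/-! ### the engine -/

section engine
variable {H : Matrix ι ι ℤ}

/-- **Faithful action of the centraliser on the orbits (engine).**  See the module docstring. -/
theorem centralizer_rowOrbits_of_prime (hH : IsHadamardMatrix H) (hι : Fintype.card ι = 668) {p f : ℕ} (hp : p.Prime)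
    (hfp : f < p) (hf : f < 336)
    (hcensus : ∀ (ψ χ : Equiv.Perm ι) (d₁ e₁ : ι → ℤ), IsSignedAut H ψ χ d₁ e₁ → ψ ^ p = 1 → χ ^ p = 1 →
      (ψ ≠ 1 ∨ χ ≠ 1) → (univ.filter fun i => ψ i = i).card = f)
    {π κ π' κ' : Equiv.Perm ι} {d e d' e' : ι → ℤ} (haut : IsSignedAut H π κ d e)
    (hπ : π ^ p = 1) (hκ : κ ^ p = 1) (hne : π ≠ 1 ∨ κ ≠ 1) (haut' : IsSignedAut H π' κ' d' e')
    (hcπ : Commute π' π) (hcκ : Commute κ' κ) (hpres : ∀ x, π x ≠ x → ∃ c : ℕ, π' x = (π ^ c) x) :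
    ∃ c : ℕ, π' = π ^ c ∧ κ' = κ ^ c := by
  have hF : (univ.filter fun i => π i = i).card = f := hcensus π κ d e haut hπ hκ hne
  -- π ≠ 1, so there is a moved row
  have hπ1 : π ≠ 1 := by
    intro h1
    have hall : (univ.filter fun i : ι => π i = i) = univ :=
      Finset.filter_true_of_mem (fun i _ => by rw [h1, Equiv.Perm.one_apply])
    rw [hall, Finset.card_univ, hι] at hF
    omega
  obtain ⟨x₀, hx₀⟩ : ∃ x, π x ≠ x := by
    by_contra h
    push Not at h
    exact hπ1 (Equiv.ext h)
  have hfree : ∀ x, π x ≠ x → ∀ k, 0 < k → k < p → (π ^ k) x ≠ x :=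
    fun x hx => free_of_fixed_prime_pow π hp (by rw [hπ, Equiv.Perm.one_apply]) hx
  obtain ⟨c₀, hc₀⟩ := hpres x₀ hx₀
  obtain ⟨m, q₀, hm⟩ : ∃ m q₀ : ℕ, c₀ + m = p * q₀ := ⟨p - c₀ % p, c₀ / p + 1, by
    have h1 := Nat.div_add_mod c₀ p; have h2 := Nat.mod_lt c₀ hp.pos; rw [Nat.mul_add, mul_one]; omega⟩
  -- ρ = τ σ^m with parts ψ, χ
  have hρ := isSignedAut_mul haut' (isSignedAut_pow haut m)
  set ψ : Equiv.Perm ι := π' * π ^ m with hψdef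
  set χ : Equiv.Perm ι := κ' * κ ^ m with hχdef
  have hcψ : Commute ψ π := hcπ.mul_left (Commute.pow_left (Commute.refl π) m)
  have hcχ : Commute χ κ := hcκ.mul_left (Commute.pow_left (Commute.refl κ) m)
  have hψpow : ∀ x, π x ≠ x → ∃ c : ℕ, ψ x = (π ^ c) x := by
    intro x hx
    obtain ⟨c, hc⟩ := hpres x hx
    refine ⟨c + m, ?_⟩
    rw [hψdef, Equiv.Perm.mul_apply, comm_apply_pow_orbit hcπ hc m, ← Equiv.Perm.mul_apply, ← pow_add]
  have hψx₀ : ψ x₀ = (π ^ 0) x₀ := by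
    rw [hψdef, Equiv.Perm.mul_apply, comm_apply_pow_orbit hcπ hc₀ m, ← Equiv.Perm.mul_apply, ← pow_add, hm, pow_mul,
      hπ, one_pow, pow_zero]
  have hfixorb : ∀ n k : ℕ, (ψ ^ n) ((π ^ k) x₀) = (π ^ k) x₀ := by
    intro n k
    rw [comm_pow_apply_pow_orbit hcψ hψx₀ n k, mul_zero, pow_zero, Equiv.Perm.one_apply]
  -- the pair R = (ψ, χ) is trivial: no prime divides its order
  set R : Equiv.Perm ι × Equiv.Perm ι := (ψ, χ) with hRdef
  have hR0 : orderOf R ≠ 0 := (orderOf_pos R).ne'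
  have hpowpair : ∀ k : ℕ, R ^ k = ((ψ ^ k, χ ^ k) : Equiv.Perm ι × Equiv.Perm ι) := fun k => by rw [hRdef, Prod.pow_mk]
  have hR1 : R = 1 := by
    by_contra hR1
    have hord1 : orderOf R ≠ 1 := fun h => hR1 (orderOf_eq_one_iff.mp h)
    obtain ⟨q, hq, hqdvd⟩ := Nat.exists_prime_and_dvd hord1
    set k := orderOf R / q with hk
    have hQ : orderOf (R ^ k) = q := orderOf_pow_orderOf_div hR0 hqdvd
    rw [hpowpair k] at hQ
    obtain ⟨h1, h2, h3⟩ := pow_data_of_orderOf hQ (a := 1) Nat.one_pos hq.one_lt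
    rw [pow_one, pow_one] at h3
    have hautQ := isSignedAut_pow hρ k
    by_cases hqp : q = p
    · -- Q has order p and fixes the orbit of x₀: p ≤ f, contradiction
      subst hqp
      have hfQ := hcensus (ψ ^ k) (χ ^ k) _ _ hautQ h1 h2 h3
      have hsub : orbFin π q x₀ ⊆ univ.filter fun i => (ψ ^ k) i = i := by
        intro z hz
        obtain ⟨j, -, rfl⟩ := Finset.mem_image.mp hz
        exact Finset.mem_filter.mpr ⟨Finset.mem_univ _, hfixorb k j⟩
      have hle := Finset.card_le_card hsub
      rw [card_orbFin_of_free (hfree x₀ hx₀), hfQ] at hle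
      omega
    · -- Q is trivial on every moved row: it fixes ≥ 668 − f > 332 rows
      have hQmoved : ∀ x, π x ≠ x → (ψ ^ k) x = x := by
        intro x hx
        obtain ⟨c, hc⟩ := hψpow x hx
        -- (ψ^k) x = π^(kc) x and ((ψ^k)^q) x = π^(q k c) x = x
        have e1 : (ψ ^ k) x = (π ^ (k * c)) x := by
          have h := comm_pow_apply_pow_orbit hcψ hc k 0
          rw [pow_zero, Equiv.Perm.one_apply] at h
          exact h
        have e2 : (π ^ (q * (k * c))) x = x := by
          have h := comm_pow_apply_pow_orbit hcψ hc (q * k) 0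
          rw [pow_zero, Equiv.Perm.one_apply, mul_comm q k, pow_mul, h1, Equiv.Perm.one_apply] at h
          rw [show q * (k * c) = k * q * c by ring]
          exact h.symm
        -- hence p ∣ q k c, and p ∣ k c
        have hdvd : p ∣ q * (k * c) := by
          by_contra hnd
          have hmod : (q * (k * c)) % p ≠ 0 := fun h0 => hnd (Nat.dvd_of_mod_eq_zero h0)
          rw [← pow_mod_of_pow_eq_one π hπ (q * (k * c))] at e2
          exact hfree x hx _ (Nat.pos_of_ne_zero hmod) (Nat.mod_lt _ hp.pos) e2
        have hdvd' : p ∣ k * c :=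
          (Nat.Coprime.dvd_of_dvd_mul_left ((Nat.coprime_primes hp hq).mpr (Ne.symm hqp)) hdvd)
        obtain ⟨t, ht⟩ := hdvd'
        rw [e1, ht, pow_mul, hπ, one_pow, Equiv.Perm.one_apply]
      have hsub : (univ.filter fun x => π x ≠ x) ⊆ univ.filter fun x => (ψ ^ k) x = x := by
        intro x hx
        exact Finset.mem_filter.mpr ⟨Finset.mem_univ _, hQmoved x (Finset.mem_filter.mp hx).2⟩
      have hmovedcard : (univ.filter fun x => π x ≠ x).card = 668 - f := by
        have h := Finset.card_filter_add_card_filter_not (s := (univ : Finset ι)) (fun x => π x = x)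
        rw [hF, Finset.card_univ, hι] at h
        have : (univ.filter fun x => ¬ π x = x) = univ.filter fun x => π x ≠ x := rfl
        rw [this] at h
        omega
      have hge := Finset.card_le_card hsub
      rw [hmovedcard] at hge
      have hle := card_fixed_le_332_of_prime_pair hH hι hautQ hq h1 h2 h3
      omega
  rw [hRdef, Prod.mk_eq_one] at hR1
  -- conclude: π' = π^((p-1) m), κ' = κ^((p-1) m)
  refine ⟨(p - 1) * m, ?_, ?_⟩
  · have hb : π ^ m * π ^ ((p - 1) * m) = 1 := by
      rw [← pow_add, show m + (p - 1) * m = p * m by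
        rcases Nat.exists_eq_succ_of_ne_zero hp.ne_zero with ⟨r, hr⟩; rw [hr]; simp; ring, pow_mul, hπ, one_pow]
    calc π' = π' * (π ^ m * π ^ ((p - 1) * m)) := by rw [hb, mul_one]
      _ = (π' * π ^ m) * π ^ ((p - 1) * m) := by rw [mul_assoc]
      _ = π ^ ((p - 1) * m) := by rw [← hψdef, hR1.1, one_mul]
  · have hb : κ ^ m * κ ^ ((p - 1) * m) = 1 := by
      rw [← pow_add, show m + (p - 1) * m = p * m by
        rcases Nat.exists_eq_succ_of_ne_zero hp.ne_zero with ⟨r, hr⟩; rw [hr]; simp; ring, pow_mul, hκ, one_pow]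
    calc κ' = κ' * (κ ^ m * κ ^ ((p - 1) * m)) := by rw [hb, mul_one]
      _ = (κ' * κ ^ m) * κ ^ ((p - 1) * m) := by rw [mul_assoc]
      _ = κ ^ ((p - 1) * m) := by rw [← hχdef, hR1.2, one_mul]

end engine

/-! ### instances: 37 and 41 -/

section instances
variable {H : Matrix ι ι ℤ} (hH : IsHadamardMatrix H) (hι : Fintype.card ι = 668)
  {π κ π' κ' : Equiv.Perm ι} {d e d' e' : ι → ℤ} (haut : IsSignedAut H π κ d e)
  (haut' : IsSignedAut H π' κ' d' e') (hcπ : Commute π' π) (hcκ : Commute κ' κ)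
  (hpres : ∀ x, π x ≠ x → ∃ c : ℕ, π' x = (π ^ c) x)
include hH hι haut haut' hcπ hcκ hpres

/-- **Order 37: the orbit-preserving centraliser is `⟨σ⟩`** (faithful action on the `18` row orbits). -/
theorem hadamard668_order37_centralizer_rowOrbits (hπ : π ^ 37 = 1) (hκ : κ ^ 37 = 1) (hne : π ≠ 1 ∨ κ ≠ 1) :
    ∃ c : ℕ, π' = π ^ c ∧ κ' = κ ^ c :=
  centralizer_rowOrbits_of_prime hH hι (by norm_num) (by norm_num) (by norm_num)
    (fun ψ χ d₁ e₁ hA h1 h2 h3 => (hadamard668_fixedRows_37 hH hι ψ χ d₁ e₁ hA h1 h2 h3).1) haut hπ hκ hne haut' hcπ hcκ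
    hpres

/-- **Order 41: the orbit-preserving centraliser is `⟨σ⟩`** (faithful action on the `16` row orbits). -/
theorem hadamard668_order41_centralizer_rowOrbits (hπ : π ^ 41 = 1) (hκ : κ ^ 41 = 1) (hne : π ≠ 1 ∨ κ ≠ 1) :
    ∃ c : ℕ, π' = π ^ c ∧ κ' = κ ^ c :=
  centralizer_rowOrbits_of_prime hH hι (by norm_num) (by norm_num) (by norm_num)
    (fun ψ χ d₁ e₁ hA h1 h2 h3 => (hadamard668_fixedRows_41 hH hι ψ χ d₁ e₁ hA h1 h2 h3).1) haut hπ hκ hne haut' hcπ hcκ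
    hpres

end instances

end Summit.Ventures.DiscreteObjects.Hadamard
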